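import Summits.BirchSwinnertonDyer.BirchSwinnertonDyer.Theorems.PrintX11aUpperNonSurjFiveMultTeichDefs
import Summits.BirchSwinnertonDyer.BirchSwinnertonDyer.Theorems.SmallImageMuTransferAnalyticMuZeroX9TeichOrbitNonConstantAtOfTeichSpanGenAll
import Summits.BirchSwinnertonDyer.BirchSwinnertonDyer.Theorems.PrintX8VerticalStevensBridgeEll
import Summits.BirchSwinnertonDyer.BirchSwinnertonDyer.Theorems.PrintX8VerticalStevensIrreducible
import Literature.NumberTheory.EllipticCurves.PlusSymbolBoundOddMultiplicativeProofs
import HarnessLib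

/-!
# Crux U5 `PrintX11a.UpperNonSurjFive` (item stmt-BirchSwinnertonDyer-20614), line finemu5 r2 ⊕ multteich5 —
# stub S2 `stub_orbitUnit_of_multTeichSpan`, PROVED: B⁰ at multiplicative level ⟹ a unit Teichmüller orbit sum

Seat `bsd-line-x11a-p3` g2 (LEAD of crux 20614), `--supports stmt-BirchSwinnertonDyer-20614` (registered stub S2 of the
reshaped skeleton of record).  Theorems only (no definition, no named fact, no `sorry`); vocabulary from
`Theorems/PrintX11aUpperNonSurjFiveMultTeichDefs.lean` (ideator bsd-idea-17's «multteich5» objects, VERBATIM).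

* `exists_sum_multPacket_eq_teichOrbitSum` — a MULT Teichmüller packet of level `n ≥ 1` (denominators `c + pd = pⁿ`,
  numerators `ν = a + pb` once through a Teichmüller coset) sums, under `g ↦ [ν(g)/pⁿ]⁺_f`, to an orbit sum
  `A_n(u) = teichOrbitSum f p n u` over a unit `u` (the transfer of `TeichSpan.exists_sum_packet_eq_teichOrbitSum` from the
  cusp `0` to the cusp `1/p`; `ν·d − b·δ = 1` makes `ν` a unit mod `pⁿ`).
* `exists_one_le_norm_teichOrbitSum_of_multTeichSpanGen` — LEVEL FORM: `f` a rational normalised newform on `Γ₀(pM)`,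
  `p` odd, a prime `ℓ ∤ pM` with `a_ℓ(f) ≢ ℓ + 1 (mod p)` (non-Eisenstein), and `MultTeichSpanGen M p` ⟹ some orbit sum
  `A_n(u)`, `n ≥ 1`, `u` a unit, has `p`-adic norm `≥ 1`.  Proof (contrapositive): if every such orbit sum has norm `< 1`,
  Manin's INTEGER period homomorphism `m : Γ₀(pM) → ℤ` (`re{∞, γ∞}_f = m(γ)·Ω⁺_f/2`; `[γr]⁺ − [r]⁺ = m(γ)/2` at every cusp
  `r` with `cr + d ≠ 0`, here `r = 1/p` and `r = 0`) kills mod `p` every packet QUOTIENT (`m(π)/2 = A_n(u) − (p−1)[1/p]⁺`,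
  so `m(ππ'⁻¹)/2 = A_n(u) − A_{n'}(u')`, of norm `< 1`), every finite-order / trace-`±2` element (exactly), every `p`-th
  power and every commutator; by `MultTeichSpanGen` it kills `γ·γ^ι` for all `γ ∈ Γ₁(pM)`, and `m(γ^ι) = m(γ)`
  (`[−r]⁺ = [r]⁺`), so `p ∣ m(γ)` on `Γ₁(pM)` — contradicting the generic `ℓ`-Hecke bridge
  `exists_mem_one_le_norm_sub_of_spanModBy_of_prime` with the trivial test set `S = Γ₁(pM)`, which produces
  `γ ∈ Γ₁(pM)` with `‖m(γ)/2‖_p ≥ 1`.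
* `stub_orbitUnit_of_multTeichSpan` — THE REGISTERED STUB S2 (curve form): S1 at every level ⟹ for `E = W/ℚ` with
  multiplicative reduction at `p ≥ 5` and `E[p]` irreducible, `MultTeichOrbitUnitAt W p` (per newform `f` of `E`: level
  `N = pM` with `p ∤ M` by `IsNewformOf.dvd_level_and_not_sq_dvd_of_multiplicative`; the non-Eisenstein prime `ℓ` from
  irreducibility by `exists_prime_not_dvd_frobeniusTrace_sub not_irreducible_of_frobeniusTrace_congr_holds`).
HONEST FRAMING: S1 (`MultTeichSpanGen`) is OPEN and displayed as the hypothesis; nothing about any curve is asserted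
unconditionally; the crux stays open.  beyond-print theorem: no (a dictionary).  BSD is not proved by any of this.
References: [Manin1972] Prop. 1.4, Thm. 1.9; [MazurTateTeitelbaum1986Invent] §I.4 (4.2), §I.10 (10.1); [Stevens1982] §1.1.
-/

-- the summit namespace repeats `BirchSwinnertonDyer` by design (summit = problem); linter moot
set_option linter.dupNamespace false
set_option autoImplicit false

noncomputable section

open scoped Classical MatrixGroups ModularForm
open CongruenceSubgroup
open Literature.NumberTheory.EllipticCurves.Rank1Residual

namespace Summit.BirchSwinnertonDyer.BirchSwinnertonDyer.Cruxes.UpperNonSurjFive.MultTeich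

open Matrix Matrix.SpecialLinearGroup WeierstrassCurve
  Literature.NumberTheory.EllipticCurves Literature.NumberTheory.EllipticCurves.ModularForms
  Summit.BirchSwinnertonDyer.BirchSwinnertonDyer.Theorems.CollapseThree
  Summit.BirchSwinnertonDyer.BirchSwinnertonDyer.Theorems.PrintX8VerticalStevens
  Summit.BirchSwinnertonDyer.BirchSwinnertonDyer.Cruxes.AnalyticMuZeroX9
  Summit.BirchSwinnertonDyer.BirchSwinnertonDyer.Cruxes.AnalyticMuZeroX9.TeichSpan

/-! ### §A Mult packets sum to orbit sums -/

section Packets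

variable {N : ℕ} [NeZero N] {f : CuspForm (Gamma0 N) 2} {p : ℕ} [Fact p.Prime]

/-- **A mult Teichmüller packet sums to an orbit sum**: if `l` is a mult packet of level `n ≥ 1` (the cusps
`g·(1/p) = ν_g/pⁿ`, `g ∈ l`, run once through a Teichmüller coset), then `Σ_{g ∈ l} [ν_g/pⁿ]⁺_f = A_n(u)` for the unit
`u = ν_{g₀} mod pⁿ`. [cite: MazurTateTeitelbaum1986Invent, §I.10 (10.1)] [cite: Washington1997, §5.1 (Teichmüller character ω)] -/
theorem exists_sum_multPacket_eq_teichOrbitSum (hp2 : p ≠ 2) {n : ℕ} (hn : 1 ≤ n) {l : List (Gamma0 N)}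
    (hl : IsMultTeichPacket N p n l) :
    ∃ u : (ZMod (p ^ n))ˣ, (l.map fun g ↦ ratPlusSymbol f (((numEntry p g : ℤ) : ℚ) / (p : ℚ) ^ n)).sum =
      teichOrbitSum f p n (u : ZMod (p ^ n)) := by
  classical
  have hp : p.Prime := Fact.out
  haveI := neZero_torsionOrder p
  haveI := Fintype.ofFinite (rootsOfUnity (torsionOrder p) ℤ_[p])
  haveI : NeZero (p ^ n) := ⟨pow_ne_zero _ hp.ne_zero⟩
  obtain ⟨hlen, hd, hnodup, c, hc⟩ := hl
  have hne : l ≠ [] := by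
    intro h; rw [h, List.length_nil] at hlen; have := hp.two_le; omega
  obtain ⟨g₀, hg₀⟩ := List.exists_mem_of_ne_nil l hne
  have hu₀ : IsUnit (((numEntry p g₀ : ℤ)) : ZMod (p ^ n)) := isUnit_numEntry_of_denEntry_eq (hd g₀ hg₀)
  set u := hu₀.unit with hu
  refine ⟨u, ?_⟩
  have huval : (u : ZMod (p ^ n)) = ((numEntry p g₀ : ℤ) : ZMod (p ^ n)) := hu₀.unit_spec
  -- the list of residues and the Teichmüller set
  set B : List (ZMod (p ^ n)) := l.map fun g ↦ ((numEntry p g : ℤ) : ZMod (p ^ n)) with hB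
  set F : Finset (ZMod (p ^ n)) := Finset.univ.filter (fun t : ZMod (p ^ n) ↦ t ^ (p - 1) = 1) with hF
  have hFcard : F.card = p - 1 := by
    rw [hF, ← image_toZModPow_rootsOfUnity_eq_filter p hp2 hn,
      Finset.card_image_of_injective _ (toZModPow_rootsOfUnity_injective_of_le p hp2 hn),
      Finset.card_univ, card_rootsOfUnity_eq hp2]
  have hcu : c = (u : ZMod (p ^ n)) ^ (p - 1) := by rw [huval, hc g₀ hg₀]
  -- `B.toFinset = F · u`
  have hBF : B.toFinset = F.image (fun t ↦ t * (u : ZMod (p ^ n))) := by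
    apply Finset.eq_of_subset_of_card_le
    · intro x hx
      rw [List.mem_toFinset, hB, List.mem_map] at hx
      obtain ⟨g, hg, rfl⟩ := hx
      rw [Finset.mem_image]
      refine ⟨((numEntry p g : ℤ) : ZMod (p ^ n)) * ((u⁻¹ : (ZMod (p ^ n))ˣ) : ZMod (p ^ n)), ?_, ?_⟩
      · rw [hF, Finset.mem_filter]
        refine ⟨Finset.mem_univ _, ?_⟩
        rw [mul_pow, hc g hg, hcu, ← Units.val_pow_eq_pow_val, ← Units.val_pow_eq_pow_val, ← Units.val_mul,
          inv_pow, mul_inv_cancel, Units.val_one]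
      · rw [mul_assoc, Units.inv_mul, mul_one]
    · rw [List.toFinset_card_of_nodup hnodup, hB, List.length_map, hlen]
      exact Finset.card_image_le.trans hFcard.le
  -- the sums
  have h1 : (l.map fun g ↦ ratPlusSymbol f (((numEntry p g : ℤ) : ℚ) / (p : ℚ) ^ n)) =
      B.map fun x ↦ ratPlusSymbol f ((x.val : ℚ) / (p : ℚ) ^ n) := by
    rw [hB, List.map_map]
    refine List.map_congr_left fun g _ ↦ ?_
    simp only [Function.comp_apply]
    exact ratPlusSymbol_intCast_div_pow (f := f) (p := p) n (numEntry p g)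
  rw [h1, ← List.sum_toFinset _ hnodup, hBF, Finset.sum_image, teichOrbitSum_def]
  intro t _ t' _ h
  exact (Units.mul_left_inj u).mp h

end Packets

/-! ### §B LEVEL FORM: B⁰ at multiplicative level ⟹ a unit orbit sum -/

section Level

variable {p : ℕ} [Fact p.Prime] {M : ℕ} [NeZero (p * M)] {f : CuspForm (Gamma0 (p * M)) 2}

/-- **B⁰ at multiplicative level gives a unit Teichmüller orbit sum** (level form).  For a rational normalised newform
`f` on `Γ₀(pM)`, `p` odd, a prime `ℓ ∤ pM` with `a_ℓ(f) ≢ ℓ + 1 (mod p)`, and `MultTeichSpanGen M p`: some orbit sum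
`A_n(u) = Σ_{η^{p−1}=1} [ηu/pⁿ]⁺_f` with `n ≥ 1` and `u` a unit has `p`-adic norm `≥ 1`.  Proof in the module docstring
(Manin's integer period homomorphism read at the cusp `1/p`; the `ι`-norm; the `ℓ`-Hecke bridge with `S = Γ₁(pM)`).
[cite: Manin1972, Prop. 1.4 and Thm. 1.9] [cite: MazurTateTeitelbaum1986Invent, §I.4 (4.2), §I.10 (10.1)] -/
theorem exists_one_le_norm_teichOrbitSum_of_multTeichSpanGen (hf : IsNewform0 f) (hQ : coeffField f = ⊥)
    (hp2 : p ≠ 2) {ℓ : ℕ} [Fact ℓ.Prime] (hℓN : ¬ ℓ ∣ p * M) {aℓ : ℤ} (haℓ : cuspCoeff f ℓ = aℓ)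
    (haℓ1 : ¬ (p : ℤ) ∣ aℓ - (ℓ + 1)) (hB : MultTeichSpanGen M p) :
    ∃ n : ℕ, 1 ≤ n ∧ ∃ a : (ZMod (p ^ n))ˣ,
      1 ≤ ‖((teichOrbitSum f p n (a : ZMod (p ^ n)) : ℚ) : ℚ_[p])‖ := by
  classical
  have hp : p.Prime := Fact.out
  have hpZ : Prime (p : ℤ) := Nat.prime_iff_prime_int.mp hp
  have hpQ : (p : ℚ) ≠ 0 := Nat.cast_ne_zero.mpr hp.ne_zero
  -- period data (Manin 1972 / the period convention `re Λ_f = ℤ·Ω⁺/2`), as in the vertical-Stevens bridge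
  have hreal : ∀ n, (cuspCoeff f n).im = 0 := cuspCoeff_im_eq_zero_of_coeffField_eq_bot hQ
  have hrat : ∀ r : ℚ, (ratPlusSymbol f r : ℝ) = normalizedPlusSymbol f r :=
    fun r ↦ ratCast_ratPlusSymbol_holds hf hQ r
  have hΩpos : 0 < plusPeriod f := (plusPeriod_pos_and_realPeriods_eq isZLattice_periodLattice_holds hf hQ).1
  have hΩ : plusPeriod f ≠ 0 := hΩpos.ne'
  have hΩ2 : plusPeriod f / 2 ≠ 0 := div_ne_zero hΩ two_ne_zero
  obtain ⟨hre, -⟩ := realPeriods_eq_zmultiples_of_plusPeriod_ne_zero f hΩ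
  choose m hm using exists_re_cuspSymbol_eq f hre
  have hm_zero : ∀ γ, cuspSymbol f γ = 0 → m γ = 0 := by
    intro γ hγ
    have h := hm γ
    rw [hγ, Complex.zero_re] at h
    exact_mod_cast (mul_eq_zero.mp h.symm).resolve_right hΩ2
  have hm_mul : ∀ γ δ, m (γ * δ) = m γ + m δ := by
    intro γ δ
    have h2 : (cuspSymbol f (γ * δ)).re = (cuspSymbol f γ).re + (cuspSymbol f δ).re := by
      rw [cuspSymbol_mul_holds f γ δ, Complex.add_re]
    rw [hm, hm, hm, ← add_mul] at h2
    exact_mod_cast mul_right_cancel₀ hΩ2 h2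
  have hm_one : m 1 = 0 := hm_zero 1 (cuspSymbol_one f)
  have hm_pow : ∀ (γ : Gamma0 (p * M)) (n : ℕ), m (γ ^ n) = n * m γ := by
    intro γ n
    induction n with
    | zero => simp [hm_one]
    | succ n ih => rw [pow_succ, hm_mul, ih]; push_cast; ring
  have hm_inv : ∀ γ : Gamma0 (p * M), m γ⁻¹ = -m γ := by
    intro γ
    have h := hm_mul γ γ⁻¹
    rw [mul_inv_cancel, hm_one] at h
    linarith
  have hm_prod : ∀ l : List (Gamma0 (p * M)), m l.prod = (l.map m).sum := by
    intro l
    induction l with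
    | nil => simp [hm_one]
    | cons a l ih => rw [List.prod_cons, hm_mul, ih, List.map_cons, List.sum_cons]
  -- Manin at a cusp `r`: `[γr]⁺ − [r]⁺ = m(γ)/2` whenever `cr + d ≠ 0`
  have hcuspR : ∀ (γ : Gamma0 (p * M)) (r : ℚ),
      ((γ : SL(2, ℤ)) 1 0 : ℚ) * r + ((γ : SL(2, ℤ)) 1 1 : ℚ) ≠ 0 →
      ratPlusSymbol f ((((γ : SL(2, ℤ)) 0 0 : ℚ) * r + ((γ : SL(2, ℤ)) 0 1 : ℚ)) /
          (((γ : SL(2, ℤ)) 1 0 : ℚ) * r + ((γ : SL(2, ℤ)) 1 1 : ℚ))) - ratPlusSymbol f r = (m γ : ℚ) / 2 := by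
    intro γ r hr
    have h := ratCast_ratPlusSymbol_moebius_sub f hrat hreal γ r hr
    rw [hm] at h
    have h' : ((ratPlusSymbol f ((((γ : SL(2, ℤ)) 0 0 : ℚ) * r + ((γ : SL(2, ℤ)) 0 1 : ℚ)) /
          (((γ : SL(2, ℤ)) 1 0 : ℚ) * r + ((γ : SL(2, ℤ)) 1 1 : ℚ))) - ratPlusSymbol f r : ℚ) : ℝ) =
        (((m γ : ℚ) / 2 : ℚ) : ℝ) := by
      push_cast
      rw [h]
      field_simp
    exact_mod_cast h'
  -- at `r = 0`: `[b/d]⁺ − [0]⁺ = m(γ)/2` for `d ≠ 0`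
  have hcusp0 : ∀ γ : Gamma0 (p * M), dEntry γ ≠ 0 →
      ratPlusSymbol f (((bEntry γ : ℤ) : ℚ) / ((dEntry γ : ℤ) : ℚ)) - ratPlusSymbol f 0 = (m γ : ℚ) / 2 := by
    intro γ hd
    have hd' : ((γ : SL(2, ℤ)) 1 0 : ℚ) * 0 + ((γ : SL(2, ℤ)) 1 1 : ℚ) ≠ 0 := by
      rw [mul_zero, zero_add]; exact_mod_cast hd
    have h := hcuspR γ 0 hd'
    simp only [mul_zero, zero_add] at h
    rw [show ((bEntry γ : ℤ) : ℚ) = ((γ : SL(2, ℤ)) 0 1 : ℚ) from rfl,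
      show ((dEntry γ : ℤ) : ℚ) = ((γ : SL(2, ℤ)) 1 1 : ℚ) from rfl]
    exact h
  -- at `r = 1/p`: `[ν/δ]⁺ − [1/p]⁺ = m(γ)/2` for `δ = c + pd ≠ 0`
  have hcuspP : ∀ γ : Gamma0 (p * M), denEntry p γ ≠ 0 →
      ratPlusSymbol f (((numEntry p γ : ℤ) : ℚ) / ((denEntry p γ : ℤ) : ℚ)) - ratPlusSymbol f (1 / (p : ℚ)) =
        (m γ : ℚ) / 2 := by
    intro γ hδ
    have hδQ : ((denEntry p γ : ℤ) : ℚ) ≠ 0 := by exact_mod_cast hδ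
    have hden : ((γ : SL(2, ℤ)) 1 0 : ℚ) * (1 / (p : ℚ)) + ((γ : SL(2, ℤ)) 1 1 : ℚ) =
        ((denEntry p γ : ℤ) : ℚ) / (p : ℚ) := by
      rw [denEntry]; push_cast; field_simp
    have hnum : ((γ : SL(2, ℤ)) 0 0 : ℚ) * (1 / (p : ℚ)) + ((γ : SL(2, ℤ)) 0 1 : ℚ) =
        ((numEntry p γ : ℤ) : ℚ) / (p : ℚ) := by
      rw [numEntry]; push_cast; field_simp
    have hr : ((γ : SL(2, ℤ)) 1 0 : ℚ) * (1 / (p : ℚ)) + ((γ : SL(2, ℤ)) 1 1 : ℚ) ≠ 0 := by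
      rw [hden]; exact div_ne_zero hδQ hpQ
    have h := hcuspR γ (1 / (p : ℚ)) hr
    rw [hden, hnum, div_div_div_cancel_right₀ hpQ] at h
    exact h
  -- suppose, for contradiction, that every orbit sum at every level `≥ 1` over a unit has norm `< 1`
  by_contra H
  push Not at H
  -- then `m` kills every packet QUOTIENT mod `p`
  have hpacket : ∀ {n : ℕ}, 1 ≤ n → ∀ {l : List (Gamma0 (p * M))}, IsMultTeichPacket (p * M) p n l →
      ∃ u : (ZMod (p ^ n))ˣ, ((m l.prod : ℚ)) / 2 =
        teichOrbitSum f p n (u : ZMod (p ^ n)) - ((p - 1 : ℕ) : ℚ) * ratPlusSymbol f (1 / (p : ℚ)) := by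
    intro n hn l hl
    have hlnd : l.Nodup := hl.2.2.1.of_map _
    have hlen : l.length = p - 1 := hl.1
    obtain ⟨u, hu⟩ := exists_sum_multPacket_eq_teichOrbitSum (f := f) hp2 hn hl
    refine ⟨u, ?_⟩
    rw [← List.sum_toFinset _ hlnd] at hu
    rw [hm_prod, ← hu, Int.cast_list_sum, List.map_map, ← List.sum_toFinset _ hlnd, Finset.sum_div, ← hlen,
      ← List.toFinset_card_of_nodup hlnd]
    rw [show ((l.toFinset.card : ℕ) : ℚ) * ratPlusSymbol f (1 / (p : ℚ)) =
        ∑ g ∈ l.toFinset, ratPlusSymbol f (1 / (p : ℚ)) by rw [Finset.sum_const, nsmul_eq_mul],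
      ← Finset.sum_sub_distrib]
    refine Finset.sum_congr rfl fun g hg ↦ ?_
    rw [List.mem_toFinset] at hg
    have hδ := denEntry_eq_of_isMultTeichPacket hl hg
    have hδ0 : denEntry p g ≠ 0 := by rw [hδ]; exact pow_ne_zero _ (by exact_mod_cast hp.ne_zero)
    rw [Function.comp_apply, ← hcuspP g hδ0, hδ]
    push_cast
    rfl
  have hquot : ∀ γ ∈ multTeichPacketQuotients (p * M) p, (p : ℤ) ∣ m γ := by
    rintro γ ⟨π, ⟨n, l, hn, hl, rfl⟩, π', ⟨n', l', hn', hl', rfl⟩, rfl⟩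
    obtain ⟨u, hu⟩ := hpacket hn hl
    obtain ⟨u', hu'⟩ := hpacket hn' hl'
    rw [hm_mul, hm_inv, ← sub_eq_add_neg]
    apply dvd_of_norm_div_two_lt_one hp2
    rw [Int.cast_sub, sub_div, hu, hu', sub_sub_sub_cancel_right]
    push_cast
    have h1 := H n hn u
    have h2 := H n' hn' u'
    exact norm_sub_lt_one h1 h2
  -- the reduction of `m` mod `p` as a homomorphism `Γ₀(pM) → ℤ/p`
  let φ : Gamma0 (p * M) →* Multiplicative (ZMod p) :=
    { toFun := fun γ ↦ Multiplicative.ofAdd (((m γ : ℤ) : ZMod p))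
      map_one' := by simp [hm_one]
      map_mul' := fun γ δ ↦ by simp [hm_mul, ofAdd_add] }
  have hφ : ∀ γ, φ γ = 1 ↔ (p : ℤ) ∣ m γ := by
    intro γ
    simp [φ, ZMod.intCast_zmod_eq_zero_iff_dvd]
  -- every generator of `MultTeichSpanGen` lies in the kernel
  have hker : Subgroup.closure (multTeichPacketQuotients (p * M) p ∪ trivialGens (p * M) ∪ pthPowers (p * M) p) ⊔
      commutator (Gamma0 (p * M)) ≤ φ.ker := by
    refine sup_le ?_ (Abelianization.commutator_subset_ker φ)
    rw [Subgroup.closure_le]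
    rintro γ ((hγ | hγ) | ⟨h, rfl⟩)
    · rw [SetLike.mem_coe, MonoidHom.mem_ker, hφ]
      exact hquot γ hγ
    · rw [SetLike.mem_coe, MonoidHom.mem_ker, hφ]
      rcases hγ with hfin | htr
      · exact ⟨0, by rw [hm_zero γ (cuspSymbol_eq_zero_of_isOfFinOrder f hfin), mul_zero]⟩
      · exact ⟨0, by rw [hm_zero γ (cuspSymbol_eq_zero_of_trEntry f htr), mul_zero]⟩
    · rw [SetLike.mem_coe, MonoidHom.mem_ker, hφ, hm_pow]
      exact ⟨m h, by ring⟩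
  -- the `ℓ`-Hecke bridge with the trivial test set `S = Γ₁(pM)`: some `γ ∈ Γ₁(pM)` has `‖m(γ)/2‖ ≥ 1`
  have hS : SpanModBy (p * M) p ((Gamma1' (p * M) : Subgroup (Gamma0 (p * M))) : Set (Gamma0 (p * M))) := by
    intro γ hγ
    exact Subgroup.mem_sup_left (Subgroup.subset_closure (Or.inl (Or.inl hγ)))
  obtain ⟨γ, hγ1, hunit⟩ := exists_mem_one_le_norm_sub_of_spanModBy_of_prime hf hQ hp2 hℓN haℓ haℓ1 _ hS
  have hγ1' : γ ∈ Gamma1' (p * M) := hγ1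
  have hd0 : dEntry γ ≠ 0 := by
    intro hd
    have hd' : ((γ : SL(2, ℤ)) 1 1 : ℤ) = 0 := hd
    rw [hd', Int.cast_zero, div_zero, sub_self, Rat.cast_zero, norm_zero] at hunit
    exact absurd hunit (not_le.mpr zero_lt_one)
  have hmγ : ¬ (p : ℤ) ∣ m γ := by
    intro hdvd
    have h := norm_div_two_lt_one_of_dvd hp2 hdvd
    rw [← hcusp0 γ hd0] at h
    exact absurd hunit (not_le.mpr h)
  -- `m(γ^ι) = m(γ)` (`[−r]⁺ = [r]⁺`)
  have hι : m (iotaGamma0 γ) = m γ := by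
    have h1 := hcusp0 (iotaGamma0 γ) (by rwa [dEntry_iotaGamma0])
    rw [bEntry_iotaGamma0, dEntry_iotaGamma0, Int.cast_neg, neg_div, ratPlusSymbol_neg f, hcusp0 γ hd0] at h1
    have h2 : (m (iotaGamma0 γ) : ℚ) = m γ := by linarith
    exact_mod_cast h2
  -- B⁰ at multiplicative level: `γ·γ^ι ∈ ker φ`, i.e. `p ∣ 2 m γ`, so `p ∣ m γ` — contradiction
  have hp2Z : ¬ (p : ℤ) ∣ 2 := fun h ↦
    hp2 ((Nat.prime_dvd_prime_iff_eq hp Nat.prime_two).mp (by exact_mod_cast h))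
  have h2 : (p : ℤ) ∣ m (γ * iotaGamma0 γ) := (hφ _).mp (hker (hB γ hγ1'))
  rw [hm_mul, hι, ← two_mul] at h2
  exact hmγ ((hpZ.dvd_or_dvd h2).resolve_left hp2Z)

end Level

/-! ### §C CURVE FORM: the registered stub S2 -/

section Curve

/-- **stub S2 of the skeleton of record (finemu5 r2 ⊕ multteich5), PROVED — `stub_orbitUnit_of_multTeichSpan`.**
B⁰ at multiplicative level (`MultTeichSpanGen M p` for every prime `p ≥ 5` and every `M` prime to `p`; OPEN, displayed as
the hypothesis) ⟹ for `E = W/ℚ` with multiplicative reduction at `p ≥ 5` and `E[p]` irreducible, some Teichmüller orbit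
sum `A_n(a)` (`n ≥ 1`, `a` a unit) of every newform of `E` has `p`-adic norm `≥ 1` (`MultTeichOrbitUnitAt W p`).  Per
newform `f`: level `N = pM`, `p ∤ M` (`IsNewformOf.dvd_level_and_not_sq_dvd_of_multiplicative`); `E[p]` irreducible gives a
good prime `ℓ ≠ p` with `a_ℓ(E) ≢ ℓ + 1 (mod p)` (`not_irreducible_of_frobeniusTrace_congr_holds`), `ℓ ∤ N`, `a_ℓ(f) = a_ℓ(E)`;
then the level form.  `5 ≤ p` is used only as `p ≠ 2`.
[cite: Manin1972, Prop. 1.4 and Thm. 1.9] [cite: MazurTateTeitelbaum1986Invent, §I.10 (10.1)] -/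
theorem stub_orbitUnit_of_multTeichSpan :
    (∀ (M p : ℕ), p.Prime → 5 ≤ p → ¬ p ∣ M → MultTeichSpanGen M p) →
    ∀ (W : WeierstrassCurve ℚ) [W.IsElliptic] [W.IsGloballyMinimal] (p : ℕ) [Fact p.Prime],
      5 ≤ p → Mult W p → Irr W p → MultTeichOrbitUnitAt W p := by
  intro hS1 W _ _ p _ hp5 hmult hirr N _ f hf
  have hp : p.Prime := Fact.out
  have hp2 : p ≠ 2 := by omega
  obtain ⟨⟨M, hM⟩, hsq, -⟩ := hf.dvd_level_and_not_sq_dvd_of_multiplicative hmult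
  subst hM
  have hpM : ¬ p ∣ M := by
    rintro ⟨k, rfl⟩
    exact hsq ⟨k, by ring⟩
  obtain ⟨ℓ, _, -, hgoodℓ, hℓ1⟩ :=
    exists_prime_not_dvd_frobeniusTrace_sub not_irreducible_of_frobeniusTrace_congr_holds W p hirr
  have hℓN : ¬ ℓ ∣ p * M := not_dvd_level_of_isNewformOf hf hgoodℓ
  exact exists_one_le_norm_teichOrbitSum_of_multTeichSpanGen hf.1 hf.coeffField_eq_bot hp2 hℓN
    (cuspCoeff_eq_frobeniusTrace_of_isNewformOf_holds hf hgoodℓ) hℓ1 (hS1 M p hp hp5 hpM)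

end Curve

/-! ### §D POINTWISE `p`-GENERIC FORM (odd `p`; the shape shared with line «multspan3» on U3, item 20613) -/

section Pointwise

/-- **Pointwise odd-`p` form of S2** (the signature of ideator bsd-idea-17's v4 stub `stub_orbitUnit_of_multTeichSpan`,
SHARED VERBATIM by «multteich5» (U5, `p ∈ {5,7}`) and «multspan3» (U3, `p = 3`)): at ONE odd prime `p`, B⁰ at the
multiplicative levels `pM` (`M` prime to `p`) ⟹ for `E = W/ℚ` with multiplicative reduction at `p` and `E[p]` irreducible, some
Teichmüller orbit sum of every newform of `E` is a `p`-adic unit (`MultTeichOrbitUnitAt W p`).  Same proof as the curve form, with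
the span hypothesis used only at the level `M = N/p` of the newform. [cite: Manin1972, Prop. 1.4 and Thm. 1.9]
[cite: MazurTateTeitelbaum1986Invent, §I.10 (10.1)] -/
theorem orbitUnitAt_of_multTeichSpanGen :
    ∀ (W : WeierstrassCurve ℚ) [W.IsElliptic] [W.IsGloballyMinimal] (p : ℕ) [Fact p.Prime],
      p ≠ 2 → (∀ M : ℕ, ¬ p ∣ M → MultTeichSpanGen M p) → Mult W p → Irr W p → MultTeichOrbitUnitAt W p := by
  intro W _ _ p _ hp2 hS1 hmult hirr N _ f hf
  obtain ⟨⟨M, hM⟩, hsq, -⟩ := hf.dvd_level_and_not_sq_dvd_of_multiplicative hmult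
  subst hM
  have hpM : ¬ p ∣ M := by
    rintro ⟨k, rfl⟩
    exact hsq ⟨k, by ring⟩
  obtain ⟨ℓ, _, -, hgoodℓ, hℓ1⟩ :=
    exists_prime_not_dvd_frobeniusTrace_sub not_irreducible_of_frobeniusTrace_congr_holds W p hirr
  have hℓN : ¬ ℓ ∣ p * M := not_dvd_level_of_isNewformOf hf hgoodℓ
  exact exists_one_le_norm_teichOrbitSum_of_multTeichSpanGen hf.1 hf.coeffField_eq_bot hp2 hℓN
    (cuspCoeff_eq_frobeniusTrace_of_isNewformOf_holds hf hgoodℓ) hℓ1 (hS1 M hpM)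

end Pointwise

end Summit.BirchSwinnertonDyer.BirchSwinnertonDyer.Cruxes.UpperNonSurjFive.MultTeich

end
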